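import Summits.QuantumFields.BalabanUV.Beta.GAN24.OneStepConstraintAxialRate
import Summits.QuantumFields.BalabanUV.Beta.GAN24.OneStepConstraintAxialDelK
import Summits.QuantumFields.BalabanUV.Beta.GAN24.StepCovarianceInputs

/-!
# `BalabanUV.Beta.GAN24.OneStepConstraintAxialDelKRate` — binder row G-an2-4 ∕ (CONV-C), routes C-R6° («VALUES») × R7 («TWO CURRENCIES») × pv09's B6 torus line, PART 183:
# THE (SR) HALF OF THE REPAIRED ONE-LOOP LETTER, ASSEMBLED: the gauge-fixed fluctuation covariances `𝒢_n = flucCov(re Δ_n, Q_ax)` of any two levels `1 ≤ n ≤ n′` on the same unit torus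
# differ by `≤ C·n⁻²·e^{−m·tdist(par x, par x′)}` with `C, m > 0` functions of `(d, Lb, a′)` ONLY — every coarse torus, NO residual hypothesis.  PART 182's rate END at `H = re Δ_n`,
# `H′ = re Δ_{n′}` with PART 181's letters and the difference letter of leaf-06's `StepCovarianceInputs.abs_reDelK_sub_le` (NE2 ∕ pv15's (1.66) strip rate `C·n⁻²`, every torus) read in the
# block distance by PART 181 (1∕2) — census V200″ (δ), (SR)  (unit b2b-balaban-gan24-p3, gen 60; v1)

NOT IN PRINT; OUR PROOF ([folklore] composition BY NAME: PART 182 `OneStepConstraintAxialRate.abs_flucCov_sub_le_QB_axial`, PART 181 `OneStepConstraintAxialDelK` (`coercive_reg_DelK_axial_of_ub`,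
`torusSupNorm_rep_sub_rep`, `abs_reDelK_le_par`) and `OneStepConstraintBlockGeometry` (`entry_decay_par_of_fine`, `form_le_of_entry_decay_par`, `not_corner_of_tree`), PART 179
`OneStepConstraintAxialCoercivity` (`reDelK_transpose`, `dotProduct_reDelK_nonneg`), leaf-06's `StepCovarianceInputs.abs_reDelK_sub_le`, leaf-03's
`AveragedPropagatorInverseUniform.exists_DelK_kernel_decay` ∕ `pdist_rep_rep`, pv09's `B6Cov2156TorusDelK.reDelK_apply`, b05's `VectorTailsCov.sum_exp_tdist_le`, `B9FromB6.decay_mono`.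
[Balaban1984PropagatorsI] (1.65)–(1.66) p. 29 and [Balaban1984PropagatorsII] (2.152)–(2.157) pp. 249–250 LOCATE the objects; [King1986] Lemma 4.5 (4.38) p. 674 is the printed SHAPE
(`|C^{(k)}(x,y) − C^{(k+n)}(x,y)| ≤ CL^{−k}e^{−δ₀|x−y|}`); nothing printed is a hypothesis.)
HONEST FRAMING (cell contract, verbatim): «discharging `BetaPertH` makes Bałaban's UV stability UNCONDITIONAL — a real constructive-QFT result; it is NOT the continuum limit
and NOT the Clay problem.»  HONEST DEPENDENCY (verbatim): «continuum YM on T⁴ ⇐ BetaPertH ∧ nine spine estimates (0/9 proved); BetaPertH ⇐ (D1) ∧ (D4) ∧ CAP+tail; G-an2-4 gates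
asym, D1 and NE2/3/4.»

WHY (census V200″ (δ)).  PART 181 assembled the (UD) half (`exists_flucCov_DelK_axial_decay`); the lineage's INPUT-triple currency (PARTs 142–160, `DecayRateInterpolation.TwoLevelDecayRate`)
wants the STEP RATE as well.  THIS FILE assembles it: with `n = L^k` the bound `C·n⁻²` is King's `θ^k`, `θ = L⁻²`.

WHAT THIS FILE PROVES (0 sorry, 0 `def`; `Lb ≥ 1`, `a, a′ > 0`):
* §1 **`abs_reDelK_sub_le_par`** (a difference letter in the fine-site `ρ_M` ∕ `rep` currency gives PART 182's `hdiff` in the block distance: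
  `ε ↦ εe^{κ(Lb−1)}`, `κ ↦ κLb`; dimension `d + 1`).
* §2 **`abs_flucCov_sub_le_DelK_axial`** (`d ≥ 2`) — PART 182's flucCov END for `H = re Δ_n`, `H′ = re Δ_{n′}` and the axial tree, modulo ONLY the letters `(h₀, δ_H)` (entry decay of both),
  `ε` (their difference) and the site profile `Kf` — symmetry, PSD, `hι`, `hUB`, the common coercivity `γ_K` (PART 181 `coercive_reg_DelK_axial_of_ub` with `h = h₀·d·Lb^d·Kf(δ_H)`) all discharged.
* §3 (dimension `d + 1 ≥ 2`) **`exists_flucCov_DelK_axial_rate`** — `∃ C, m > 0` such that for EVERY coarse torus `M′`, all levels `1 ≤ n ≤ n′` and all unit bonds `x, x′`: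
  `|(flucCov (re Δ_{n′}) Q_ax − flucCov (re Δ_n) Q_ax)(x,x′)| ≤ C·(n²)⁻¹·e^{−m·tdist(par x, par x′)}` — no residual hypothesis (the common rate is `min(δ₀, κ₁₆₆∕(d+1))·Lb` before PART 180's
  `rate`s; the quadratic-in-ε terms of PART 114 are absorbed using `n ≥ 1`).
WHAT IT IS NOT: EL₂ (the volume limit of `𝒢_n`) and the identification with pv09's `bondReductionT … .cov` are not here; constants existential in size; `U = 1`, first-order MODEL framing
unchanged.  SUPPLIER work; NEVER «G-an2-4 closed»; NOT (CONV-C), NOT D1, NOT `BetaPertH`, NOT continuum, NOT Clay.  Records: `HOME/b2b-balaban-gan24-p3/gen60/README.md`.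
-/

noncomputable section

open scoped BigOperators Matrix ComplexOrder
open Finset Matrix

namespace Summit.QuantumFields.BalabanUV.Beta.GAN24.OneStepConstraintAxialDelKRate

open Literature.MathematicalPhysics.QuantumFieldTheory.Balaban1983to89
open Literature.MathematicalPhysics.QuantumFieldTheory.Balaban1983to89.B4Sect5Torus (rate rate_pos)
open Literature.MathematicalPhysics.QuantumFieldTheory.Balaban1983to89.Beta.CompositionSingular (flucCov)
open Literature.MathematicalPhysics.QuantumFieldTheory.Balaban1983to89.B5Prop11Plancherel (Tor fine)
open Literature.MathematicalPhysics.QuantumFieldTheory.Balaban1983to89.B5RealFields (reM reM_apply)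
open Literature.MathematicalPhysics.QuantumFieldTheory.Balaban1983to89.Beta.VectorTailsCov (tdist tdist_comm sum_exp_tdist_le)
open Literature.MathematicalPhysics.QuantumFieldTheory.Balaban1983to89.Beta.BlockEffectiveAction (DelK)
open Literature.MathematicalPhysics.QuantumFieldTheory.Balaban1983to89.B6Cov2156Torus (one_le_M)
open Literature.MathematicalPhysics.QuantumFieldTheory.Balaban1983to89.B6Cov2156TorusDelK (idxEquiv gamma2153one gamma2153one_pos reDelK reDelK_apply)
open Literature.MathematicalPhysics.QuantumFieldTheory.Balaban1983to89.B6LowerBound2153Torus (rep)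
open Literature.MathematicalPhysics.QuantumFieldTheory.Balaban1983to89.B6BondEliminationTorus (pdist)
open Literature.MathematicalPhysics.QuantumFieldTheory.Balaban1983to89.B4TorusKernel (periodConst)
open Literature.MathematicalPhysics.QuantumFieldTheory.Balaban1983to89.B4TorusKernel.MultiPeriod (torusSupNorm)
open Literature.MathematicalPhysics.QuantumFieldTheory.Balaban1983to89.B5Symbol166Strip (kappa166 kappa166_pos)
open Literature.MathematicalPhysics.QuantumFieldTheory.Balaban1983to89.T4Rate166StripDirect (C166 C166_pos)
open Literature.MathematicalPhysics.QuantumFieldTheory.Balaban1983to89.B5Kernel166Decay (periodConst_pos)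
open Summit.QuantumFields.BalabanUV.T4Continuum.BalabanLineAverage (QB)
open Summit.QuantumFields.BalabanUV.T4Continuum.BalabanAveragedTowerModes (par rem)
open Summit.QuantumFields.BalabanUV.Beta.GAN24.OneStepConstraintAxialCoercivity (reDelK_transpose dotProduct_reDelK_nonneg)
open Summit.QuantumFields.BalabanUV.Beta.GAN24.OneStepConstraintBlockGeometry (entry_decay_par_of_fine form_le_of_entry_decay_par not_corner_of_tree)
open Summit.QuantumFields.BalabanUV.Beta.GAN24.OneStepConstraintAxialDelK (coercive_reg_DelK_axial_of_ub torusSupNorm_rep_sub_rep abs_reDelK_le_par)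
open Summit.QuantumFields.BalabanUV.Beta.GAN24.OneStepConstraintAxialRate (abs_flucCov_sub_le_QB_axial)
open Summit.QuantumFields.BalabanUV.Beta.GAN24.AveragedPropagatorInverseUniform (exists_DelK_kernel_decay pdist_rep_rep)
open Summit.QuantumFields.BalabanUV.Beta.GAN24.StepCovarianceInputs (abs_reDelK_sub_le)

variable {d : ℕ} (Lb : ℕ) [NeZero Lb] (M' : Fin d → ℕ) [hM' : ∀ μ, NeZero (M' μ)] (a : ℝ) (ha : 0 < a)

/-! ## §1 The difference letter read in the block distance -/

section Letters

variable (M₁ : Fin (d + 1) → ℕ) [hM₁ : ∀ μ, NeZero (M₁ μ)]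

omit hM' in
/-- **`abs_reDelK_sub_le_par` — THE DIFFERENCE LETTER, DISCHARGED SHAPE**: a two-level difference bound in the fine-site periodic distance, `|re Δ_{n′}(s,s′) − re Δ_n(s,s′)| ≤ ε·e^{−κ·ρ_M(rep s, rep s′)}`
(`ε, κ ≥ 0`), gives PART 182's `hdiff` in the block distance: `|(re Δ_n − re Δ_{n′})(x,x′)| ≤ εe^{κ(Lb−1)}·e^{−(κLb)·tdist(par x, par x′)}` (leaf-03's `pdist_rep_rep`, PART 181's
`torusSupNorm_rep_sub_rep`, `entry_decay_par_of_fine`). [folklore] -/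
theorem abs_reDelK_sub_le_par (n n' : ℕ) [NeZero n] [NeZero n'] (hn : 1 ≤ n) (hn' : 1 ≤ n') {ε κ : ℝ} (hε : 0 ≤ ε) (hκ : 0 ≤ κ)
    (hdiff : ∀ s s' : Tor (fine (Lb * 1) M₁) × Fin (d + 1), |(DelK n' hn' (fine (Lb * 1) M₁) a ha s s').re - (DelK n hn (fine (Lb * 1) M₁) a ha s s').re| ≤
      ε * Real.exp (-(κ * pdist (fine (Lb * 1) M₁) (one_le_M (fine (Lb * 1) M₁)) (rep (fine (Lb * 1) M₁) s.1) (rep (fine (Lb * 1) M₁) s'.1))))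
    (x x' : Tor (fine (Lb * 1) M₁) × Fin (d + 1)) :
    |(reM (DelK n hn (fine (Lb * 1) M₁) a ha) - reM (DelK n' hn' (fine (Lb * 1) M₁) a ha)) x x'| ≤ ε * Real.exp (κ * ((Lb : ℝ) - 1)) * Real.exp (-(κ * Lb * (tdist (par 1 Lb M₁ x.1) (par 1 Lb M₁ x'.1) : ℝ))) := by
  refine entry_decay_par_of_fine 1 Lb M₁ (H := reM (DelK n hn (fine (Lb * 1) M₁) a ha) - reM (DelK n' hn' (fine (Lb * 1) M₁) a ha)) hε hκ (fun s s' => ?_) x x'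
  rw [Matrix.sub_apply, reM_apply, reM_apply, abs_sub_comm, ← torusSupNorm_rep_sub_rep, ← pdist_rep_rep]
  exact hdiff s s'

end Letters

/-! ## §2 PART 182's flucCov END for two levels of `re Δ`, modulo the letters `(h₀, δ_H, ε, Kf)` -/

section End

/-- **`abs_flucCov_sub_le_DelK_axial`** (`d ≥ 2`) — PART 182 `abs_flucCov_sub_le_QB_axial` at `H = re Δ_n`, `H′ = re Δ_{n′}` and the axial tree: symmetry, PSD, `hι`, `hUB` and the common
coercivity `γ_K` (PART 181 `coercive_reg_DelK_axial_of_ub` with `h = h₀·d·Lb^d·Kf(δ_H)`) are discharged; left are the entry-decay letter `(h₀, δ_H)` of both levels, their difference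
amplitude `ε`, and the site profile `Kf`.  `|(𝒢_{n′} − 𝒢_n)(x,x′)| ≤ (PART 114's constant)·e^{−(m′∕4)·tdist(par x, par x′)}`, every term with a factor `ε_E = (2∕γ_K)²·ε·(d·Lb^d·Kf(r_F∕2))²`. [folklore] -/
theorem abs_flucCov_sub_le_DelK_axial (hd : 2 ≤ d) (n n' : ℕ) [NeZero n] [NeZero n'] (hn : 1 ≤ n) (hn' : 1 ≤ n') {Kf : ℝ → ℝ} (hKf0 : ∀ s : ℝ, 0 < s → 0 ≤ Kf s)
    (hKf : ∀ s : ℝ, 0 < s → ∀ y : Tor (fine 1 M'), ∑ y' : Tor (fine 1 M'), Real.exp (-(s * (tdist y y' : ℝ))) ≤ Kf s)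
    {h₀ δH : ℝ} (hh₀ : 0 ≤ h₀) (hδH : 0 < δH)
    (hHent : ∀ x x', |reM (DelK n hn (fine (Lb * 1) M') a ha) x x'| ≤ h₀ * Real.exp (-(δH * (tdist (par 1 Lb M' x.1) (par 1 Lb M' x'.1) : ℝ))))
    (hHent' : ∀ x x', |reM (DelK n' hn' (fine (Lb * 1) M') a ha) x x'| ≤ h₀ * Real.exp (-(δH * (tdist (par 1 Lb M' x.1) (par 1 Lb M' x'.1) : ℝ))))
    {ε : ℝ} (hε : 0 ≤ ε)
    (hdiff : ∀ x x', |(reM (DelK n hn (fine (Lb * 1) M') a ha) - reM (DelK n' hn' (fine (Lb * 1) M') a ha)) x x'| ≤ ε * Real.exp (-(δH * (tdist (par 1 Lb M' x.1) (par 1 Lb M' x'.1) : ℝ))))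
    {a' : ℝ} (ha' : 0 < a') {h γK cK rF r c₀ c₁ Λ εE rU' : ℝ} (hh : h = h₀ * ((d : ℝ) * (Lb : ℝ) ^ d * Kf δH))
    (hγK : γK = (max (4 / gamma2153one d (Lb * 1)) ((4 * h * (4 * ((Lb : ℝ) ^ d) ^ 2 * (1 + ((Lb : ℝ) ^ d)⁻¹) + 2 * 1) / gamma2153one d (Lb * 1) + 2 * (4 * ((Lb : ℝ) ^ d) ^ 2 * (1 + ((Lb : ℝ) ^ d)⁻¹) + 2 * 1)) / a'))⁻¹)
    (hcK : cK = (h₀ + a' * ((((Lb : ℝ)) ^ d)⁻¹ * (((Lb : ℝ)) ^ d)⁻¹) * Real.exp (2 * δH)) + a')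
    (hrF : rF = rate (fun s => (d : ℝ) * (Lb : ℝ) ^ d * Kf s) γK cK δH) (hr : r = rF / 2) (hc₀ : c₀ = 2 / γK * Real.exp (2 * rF)) (hc₁ : c₁ = 2 / γK * Real.exp rF)
    (hΛ : Λ = h * (4 * ((Lb : ℝ) ^ d) ^ 2 * (1 + ((Lb : ℝ) ^ d)⁻¹) + 2 * 1)) (hεE : εE = (2 / γK) ^ 2 * ε * ((d : ℝ) * (Lb : ℝ) ^ d * Kf (rF / 2)) ^ 2)
    (hrU' : rU' = rate (fun s => (d : ℝ) * (1 + (Lb : ℝ) ^ d) * Kf s) (Λ + a')⁻¹ c₀ r)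
    (x x' : Tor (fine (Lb * 1) M') × Fin d) :
    |(flucCov (reM (DelK n' hn' (fine (Lb * 1) M') a ha)) (Matrix.fromRows (reM (QB 1 Lb M')) (fun (t : {x : Tor (fine (Lb * 1) M') × Fin d // (∀ ν, ν < x.2 → ((rem 1 Lb M' x.1 ν : ℕ)) = 0) ∧ ((rem 1 Lb M' x.1 x.2 : ℕ)) + 1 < Lb}) (x : Tor (fine (Lb * 1) M') × Fin d) => if x = (Function.Embedding.subtype (fun x : Tor (fine (Lb * 1) M') × Fin d => (∀ ν, ν < x.2 → ((rem 1 Lb M' x.1 ν : ℕ)) = 0) ∧ ((rem 1 Lb M' x.1 x.2 : ℕ)) + 1 < Lb)) t then (1 : ℝ) else 0)) - flucCov (reM (DelK n hn (fine (Lb * 1) M') a ha)) (Matrix.fromRows (reM (QB 1 Lb M')) (fun (t : {x : Tor (fine (Lb * 1) M') × Fin d // (∀ ν, ν < x.2 → ((rem 1 Lb M' x.1 ν : ℕ)) = 0) ∧ ((rem 1 Lb M' x.1 x.2 : ℕ)) + 1 < Lb}) (x : Tor (fine (Lb * 1) M') × Fin d) => if x = (Function.Embedding.subtype (fun x : Tor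 (fine (Lb * 1) M') × Fin d => (∀ ν, ν < x.2 → ((rem 1 Lb M' x.1 ν : ℕ)) = 0) ∧ ((rem 1 Lb M' x.1 x.2 : ℕ)) + 1 < Lb)) t then (1 : ℝ) else 0))) x x'| ≤
      (εE + ((2 * (Λ + a') * ((1 : ℝ) * εE * Real.exp (r * 1)) +
              4 * (Λ + a') ^ 2 * ((d : ℝ) * (1 + (Lb : ℝ) ^ d) * Kf (rU' / 2)) ^ 2 * c₁ * ((1 : ℝ) ^ 2 * εE * Real.exp (r * 2))) *
            ((d : ℝ) * (1 + (Lb : ℝ) ^ d) * Kf (min r (rU' / 2) / 2)) * (c₁ + (1 : ℝ) * εE * Real.exp (r * 1)) +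
          2 * (Λ + a') * c₁ * ((d : ℝ) * (1 + (Lb : ℝ) ^ d) * Kf (min r rU' / 2)) * ((1 : ℝ) * εE * Real.exp (r * 1))) *
        ((d : ℝ) * (1 + (Lb : ℝ) ^ d) * Kf (min r (rU' / 2) / 4))) *
        Real.exp (-(min r (rU' / 2) / 4 * (tdist (par 1 Lb M' x.1) (par 1 Lb M' x'.1) : ℝ))) := by
  have hι := not_corner_of_tree 1 Lb M'
  have hh0 : 0 ≤ h := by rw [hh]; have := hKf0 δH hδH; positivity
  have hHub := form_le_of_entry_decay_par 1 Lb M' (reDelK_transpose Lb M' n hn a ha) hKf hh₀ hδH hHent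
  have hHub' := form_le_of_entry_decay_par 1 Lb M' (reDelK_transpose Lb M' n' hn' a ha) hKf hh₀ hδH hHent'
  simp_rw [← hh] at hHub hHub'
  have hγK0 : 0 < γK := by
    rw [hγK]
    exact inv_pos.mpr (lt_of_lt_of_le (div_pos four_pos (gamma2153one_pos (le_trans (by norm_num) hd) (Nat.one_le_iff_ne_zero.2 (NeZero.ne (Lb * 1))))) (le_max_left _ _))
  have hK := coercive_reg_DelK_axial_of_ub Lb M' n hn a ha hd hh0 hHub ha'
  have hK' := coercive_reg_DelK_axial_of_ub Lb M' n' hn' a ha hd hh0 hHub' ha'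
  rw [← hγK] at hK hK'
  exact abs_flucCov_sub_le_QB_axial 1 Lb M' (Function.Embedding.subtype (fun x : Tor (fine (Lb * 1) M') × Fin d => (∀ ν, ν < x.2 → ((rem 1 Lb M' x.1 ν : ℕ)) = 0) ∧ ((rem 1 Lb M' x.1 x.2 : ℕ)) + 1 < Lb)) hι hKf0 hKf (reDelK_transpose Lb M' n hn a ha) (dotProduct_reDelK_nonneg Lb M' n hn a ha)
    (reDelK_transpose Lb M' n' hn' a ha) (dotProduct_reDelK_nonneg Lb M' n' hn' a ha) hh0 hHub hHub' hγK0 ha' hh₀ hδH hK hK' hHent hHent' hε hdiff hcK hrF hr hc₀ hc₁ hΛ hεE hrU' x x'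

end End

/-! ## §3 Dimension `d + 1`: the assembled (SR) statement -/

section Assembled

omit [NeZero Lb] hM' in
/-- the algebra of PART 114's constant: it is `ε_E` times a factor that is MONOTONE in `ε_E` (all other letters nonnegative). [folklore] -/
theorem rateConst_le {εE εM Λa r c₁ K1 K2 K3 K4 : ℝ} (hεE : 0 ≤ εE) (hle : εE ≤ εM) (hΛa : 0 ≤ Λa) (hc₁ : 0 ≤ c₁) (hK2 : 0 ≤ K2) (hK4 : 0 ≤ K4) :
    (εE + ((2 * Λa * ((1 : ℝ) * εE * Real.exp (r * 1)) + 4 * Λa ^ 2 * K1 ^ 2 * c₁ * ((1 : ℝ) ^ 2 * εE * Real.exp (r * 2))) * K2 * (c₁ + (1 : ℝ) * εE * Real.exp (r * 1)) +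
        2 * Λa * c₁ * K3 * ((1 : ℝ) * εE * Real.exp (r * 1))) * K4)
      ≤ εE * (1 + ((2 * Λa * Real.exp (r * 1) + 4 * Λa ^ 2 * K1 ^ 2 * c₁ * Real.exp (r * 2)) * K2 * (c₁ + εM * Real.exp (r * 1)) +
        2 * Λa * c₁ * K3 * Real.exp (r * 1)) * K4) := by
  have e : (εE + ((2 * Λa * ((1 : ℝ) * εE * Real.exp (r * 1)) + 4 * Λa ^ 2 * K1 ^ 2 * c₁ * ((1 : ℝ) ^ 2 * εE * Real.exp (r * 2))) * K2 * (c₁ + (1 : ℝ) * εE * Real.exp (r * 1)) +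
        2 * Λa * c₁ * K3 * ((1 : ℝ) * εE * Real.exp (r * 1))) * K4)
      = εE * (1 + ((2 * Λa * Real.exp (r * 1) + 4 * Λa ^ 2 * K1 ^ 2 * c₁ * Real.exp (r * 2)) * K2 * (c₁ + εE * Real.exp (r * 1)) +
        2 * Λa * c₁ * K3 * Real.exp (r * 1)) * K4) := by ring
  rw [e]
  have hA : 0 ≤ (2 * Λa * Real.exp (r * 1) + 4 * Λa ^ 2 * K1 ^ 2 * c₁ * Real.exp (r * 2)) * K2 := by positivity
  have h1 : c₁ + εE * Real.exp (r * 1) ≤ c₁ + εM * Real.exp (r * 1) := by nlinarith [Real.exp_pos (r * 1)]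
  have h2 := mul_le_mul_of_nonneg_left h1 hA
  have h3 : (1 + ((2 * Λa * Real.exp (r * 1) + 4 * Λa ^ 2 * K1 ^ 2 * c₁ * Real.exp (r * 2)) * K2 * (c₁ + εE * Real.exp (r * 1)) +
        2 * Λa * c₁ * K3 * Real.exp (r * 1)) * K4)
      ≤ (1 + ((2 * Λa * Real.exp (r * 1) + 4 * Λa ^ 2 * K1 ^ 2 * c₁ * Real.exp (r * 2)) * K2 * (c₁ + εM * Real.exp (r * 1)) +
        2 * Λa * c₁ * K3 * Real.exp (r * 1)) * K4) := by nlinarith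
  exact mul_le_mul_of_nonneg_left h3 hεE
set_option maxHeartbeats 400000 in
/-- **`exists_flucCov_DelK_axial_rate` — THE (SR) HALF OF THE REPAIRED ONE-LOOP LETTER, ASSEMBLED, NO RESIDUAL HYPOTHESIS**: in dimension `d + 1 ≥ 2`, for every blocking factor `Lb ≥ 1`
and all dummies `a, a′ > 0` there are `C` and `m > 0` (functions of `d, Lb, a′`) such that for EVERY coarse torus `M′`, ALL levels `1 ≤ n ≤ n′` and all unit-lattice bonds `x, x′`:
`|(flucCov (re Δ_{n′}) Q_ax − flucCov (re Δ_n) Q_ax)(x,x′)| ≤ C·(n²)⁻¹·e^{−m·tdist(par x, par x′)}` (`Q_ax = fromRows (re QB 1 Lb M′) E_tree`; Bałaban's `C(C*Δ_kC)⁻¹C*` at two fine spacings).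
Along the tower `n = L^k` this is King's `θ^k` with `θ = L⁻²`. [folklore] -/
theorem exists_flucCov_DelK_axial_rate (hd : 1 ≤ d) {a' : ℝ} (ha' : 0 < a') :
    ∃ C m : ℝ, 0 < m ∧ ∀ (M₁ : Fin (d + 1) → ℕ) [∀ μ, NeZero (M₁ μ)] (n n' : ℕ) [NeZero n] [NeZero n'] (hn : 1 ≤ n) (hn' : 1 ≤ n'), n ≤ n' →
      ∀ x x' : Tor (fine (Lb * 1) M₁) × Fin (d + 1),
      |(flucCov (reM (DelK n' hn' (fine (Lb * 1) M₁) a ha)) (Matrix.fromRows (reM (QB 1 Lb M₁)) (fun (t : {x : Tor (fine (Lb * 1) M₁) × Fin (d + 1) // (∀ ν, ν < x.2 → ((rem 1 Lb M₁ x.1 ν : ℕ)) = 0) ∧ ((rem 1 Lb M₁ x.1 x.2 : ℕ)) + 1 < Lb}) (x : Tor (fine (Lb * 1) M₁) × Fin (d + 1)) => if x = (Function.Embedding.subtype (fun x : Tor (fine (Lb * 1) M₁) × Fin (d + 1) => (∀ ν, ν < x.2 → ((rem 1 Lb M₁ x.1 ν : ℕ)) = 0) ∧ ((rem 1 Lb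 M₁ x.1 x.2 : ℕ)) + 1 < Lb)) t then (1 : ℝ) else 0)) - flucCov (reM (DelK n hn (fine (Lb * 1) M₁) a ha)) (Matrix.fromRows (reM (QB 1 Lb M₁)) (fun (t : {x : Tor (fine (Lb * 1) M₁) × Fin (d + 1) // (∀ ν, ν < x.2 → ((rem 1 Lb M₁ x.1 ν : ℕ)) = 0) ∧ ((rem 1 Lb M₁ x.1 x.2 : ℕ)) + 1 < Lb}) (x : Tor (fine (Lb * 1) M₁) × Fin (d + 1)) => if x = (Function.Embedding.subtype (fun x : Tor (fine (Lb * 1) M₁) × Fin (d + 1) => (∀ ν, ν < x.2 → ((rem 1 Lb M₁ x.1 ν : ℕ)) = 0) ∧ ((rem 1 Lb M₁ x.1 x.2 : ℕ)) + 1 < Lb)) t then (1 : ℝ) else 0))) x x'| ≤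
        C * ((n : ℝ) ^ 2)⁻¹ * Real.exp (-(m * (tdist (par 1 Lb M₁ x.1) (par 1 Lb M₁ x'.1) : ℝ))) := by
  have hd' : 2 ≤ d + 1 := by omega
  have hLb1 : (1 : ℝ) ≤ Lb := by exact_mod_cast Nat.one_le_iff_ne_zero.2 (NeZero.ne Lb)
  -- the d-only kernel decay of `Δ_k` and the volume-uniform site profile
  obtain ⟨c₀, δ₀, hc₀, hδ₀, hker⟩ := exists_DelK_kernel_decay (d := d)
  have hex : ∀ s : ℝ, ∃ S : ℝ, 0 ≤ S ∧ (0 < s → ∀ (N : Fin (d + 1) → ℕ) [∀ μ, NeZero (N μ)] (y : (μ : Fin (d + 1)) → ZMod (N μ)),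
      ∑ y', Real.exp (-(s * (tdist y y' : ℝ))) ≤ S) := by
    intro s
    by_cases hs : 0 < s
    · obtain ⟨S, hS0, hS⟩ := sum_exp_tdist_le (d := d + 1) hd' hs
      exact ⟨S, hS0, fun _ => hS⟩
    · exact ⟨0, le_rfl, fun h => absurd h hs⟩
  choose Kf hKf0' hKf' using hex
  have hKf0 : ∀ s : ℝ, 0 < s → 0 ≤ Kf s := fun s _ => hKf0' s
  -- the common fine rate and the letters (opaque names with defining equations)
  have hκ0 : 0 < kappa166 (d + 1) / ((d : ℝ) + 1) := div_pos (kappa166_pos _) (by positivity)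
  obtain ⟨δc, hδc⟩ : ∃ δc : ℝ, δc = min δ₀ (kappa166 (d + 1) / ((d : ℝ) + 1)) := ⟨_, rfl⟩
  have hδc0 : 0 < δc := by rw [hδc]; exact lt_min hδ₀ hκ0
  have hδcδ₀ : δc ≤ δ₀ := by rw [hδc]; exact min_le_left _ _
  have hδcκ : δc ≤ kappa166 (d + 1) / ((d : ℝ) + 1) := by rw [hδc]; exact min_le_right _ _
  obtain ⟨h₀, hh₀⟩ : ∃ h₀ : ℝ, h₀ = c₀ * Real.exp (δc * ((Lb : ℝ) - 1)) := ⟨_, rfl⟩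
  obtain ⟨δH, hδH⟩ : ∃ δH : ℝ, δH = δc * Lb := ⟨_, rfl⟩
  have hh₀0 : 0 ≤ h₀ := by rw [hh₀]; positivity
  have hδH0 : 0 < δH := by rw [hδH]; positivity
  obtain ⟨Cd, hCd⟩ : ∃ Cd : ℝ, Cd = (((d : ℝ) + 1) ^ 2 * (4 * (8 * C166 (d + 1) * periodConst (kappa166 (d + 1)) d))) := ⟨_, rfl⟩
  have hCd0 : 0 ≤ Cd := by rw [hCd]; have := C166_pos (d + 1); have := periodConst_pos (kappa166_pos (d + 1)) d; positivity
  obtain ⟨εM, hεM⟩ : ∃ εM : ℝ, εM = Cd * Real.exp (δc * ((Lb : ℝ) - 1)) := ⟨_, rfl⟩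
  have hεM0 : 0 ≤ εM := by rw [hεM]; positivity
  -- PART 180's constants
  obtain ⟨h, hh⟩ : ∃ h : ℝ, h = h₀ * (((d + 1 : ℕ) : ℝ) * (Lb : ℝ) ^ (d + 1) * Kf δH) := ⟨_, rfl⟩
  obtain ⟨γK, hγK⟩ : ∃ γK : ℝ, γK = (max (4 / gamma2153one (d + 1) (Lb * 1)) ((4 * h * (4 * ((Lb : ℝ) ^ (d + 1)) ^ 2 * (1 + ((Lb : ℝ) ^ (d + 1))⁻¹) + 2 * 1) / gamma2153one (d + 1) (Lb * 1)
    + 2 * (4 * ((Lb : ℝ) ^ (d + 1)) ^ 2 * (1 + ((Lb : ℝ) ^ (d + 1))⁻¹) + 2 * 1)) / a'))⁻¹ := ⟨_, rfl⟩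
  obtain ⟨cK, hcK⟩ : ∃ cK : ℝ, cK = (h₀ + a' * ((((Lb : ℝ)) ^ (d + 1))⁻¹ * (((Lb : ℝ)) ^ (d + 1))⁻¹) * Real.exp (2 * δH)) + a' := ⟨_, rfl⟩
  obtain ⟨rF, hrF⟩ : ∃ rF : ℝ, rF = rate (fun s => ((d + 1 : ℕ) : ℝ) * (Lb : ℝ) ^ (d + 1) * Kf s) γK cK δH := ⟨_, rfl⟩
  obtain ⟨r, hr⟩ : ∃ r : ℝ, r = rF / 2 := ⟨_, rfl⟩
  obtain ⟨c₀', hc₀'⟩ : ∃ c₀' : ℝ, c₀' = 2 / γK * Real.exp (2 * rF) := ⟨_, rfl⟩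
  obtain ⟨c₁, hc₁⟩ : ∃ c₁ : ℝ, c₁ = 2 / γK * Real.exp rF := ⟨_, rfl⟩
  obtain ⟨Λ, hΛ⟩ : ∃ Λ : ℝ, Λ = h * (4 * ((Lb : ℝ) ^ (d + 1)) ^ 2 * (1 + ((Lb : ℝ) ^ (d + 1))⁻¹) + 2 * 1) := ⟨_, rfl⟩
  obtain ⟨rU', hrU'⟩ : ∃ rU' : ℝ, rU' = rate (fun s => ((d + 1 : ℕ) : ℝ) * (1 + (Lb : ℝ) ^ (d + 1)) * Kf s) (Λ + a')⁻¹ c₀' r := ⟨_, rfl⟩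
  obtain ⟨εEM, hεEM⟩ : ∃ εEM : ℝ, εEM = (2 / γK) ^ 2 * εM * (((d + 1 : ℕ) : ℝ) * (Lb : ℝ) ^ (d + 1) * Kf (rF / 2)) ^ 2 := ⟨_, rfl⟩
  -- positivity
  have hγ₀ : 0 < gamma2153one (d + 1) (Lb * 1) := gamma2153one_pos (by omega) (Nat.one_le_iff_ne_zero.2 (NeZero.ne (Lb * 1)))
  have hh0 : 0 ≤ h := by rw [hh]; have := hKf0' δH; positivity
  have hγK0 : 0 < γK := by rw [hγK]; exact inv_pos.mpr (lt_of_lt_of_le (div_pos four_pos hγ₀) (le_max_left _ _))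
  have hcK0 : 0 ≤ cK := by rw [hcK]; positivity
  have hprofF : ∀ s : ℝ, 0 < s → 0 ≤ ((d + 1 : ℕ) : ℝ) * (Lb : ℝ) ^ (d + 1) * Kf s := fun s hs => by have := hKf0' s; positivity
  have hprofU : ∀ s : ℝ, 0 < s → 0 ≤ ((d + 1 : ℕ) : ℝ) * (1 + (Lb : ℝ) ^ (d + 1)) * Kf s := fun s hs => by have := hKf0' s; positivity
  have hrF0 : 0 < rF := by rw [hrF]; exact rate_pos hprofF hγK0 hcK0 hδH0
  have hr0 : 0 < r := by rw [hr]; positivity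
  have hΛ0 : 0 ≤ Λ := by rw [hΛ]; positivity
  have hc₀'0 : 0 ≤ c₀' := by rw [hc₀']; positivity
  have hc₁0 : 0 ≤ c₁ := by rw [hc₁]; positivity
  have hrU0 : 0 < rU' := by rw [hrU']; exact rate_pos hprofU (inv_pos.mpr (by positivity)) hc₀'0 hr0
  have hεEM0 : 0 ≤ εEM := by rw [hεEM]; positivity
  have hK2 : 0 ≤ (((d + 1 : ℕ) : ℝ) * (1 + (Lb : ℝ) ^ (d + 1)) * Kf (min r (rU' / 2) / 2)) := hprofU _ (by positivity)
  have hK4 : 0 ≤ (((d + 1 : ℕ) : ℝ) * (1 + (Lb : ℝ) ^ (d + 1)) * Kf (min r (rU' / 2) / 4)) := hprofU _ (by positivity)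
  refine ⟨εEM * (1 + ((2 * (Λ + a') * Real.exp (r * 1) + 4 * (Λ + a') ^ 2 * (((d + 1 : ℕ) : ℝ) * (1 + (Lb : ℝ) ^ (d + 1)) * Kf (rU' / 2)) ^ 2 * c₁ * Real.exp (r * 2)) * (((d + 1 : ℕ) : ℝ) * (1 + (Lb : ℝ) ^ (d + 1)) * Kf (min r (rU' / 2) / 2)) *
        (c₁ + εEM * Real.exp (r * 1)) + 2 * (Λ + a') * c₁ * (((d + 1 : ℕ) : ℝ) * (1 + (Lb : ℝ) ^ (d + 1)) * Kf (min r rU' / 2)) * Real.exp (r * 1)) * (((d + 1 : ℕ) : ℝ) * (1 + (Lb : ℝ) ^ (d + 1)) * Kf (min r (rU' / 2) / 4))),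
    min r (rU' / 2) / 4, by positivity, fun M₁ _ n n' _ _ hn hn' hnn' x x' => ?_⟩
  -- the letters at this torus and these levels, in the named form
  have hn1 : (1 : ℝ) ≤ n := by exact_mod_cast hn
  have hn2le : ((n : ℝ) ^ 2)⁻¹ ≤ 1 := inv_le_one_of_one_le₀ (by nlinarith)
  have hkerc : ∀ (k : ℕ) [NeZero k] (hk : 1 ≤ k) (q' q : Tor (fine (Lb * 1) M₁) × Fin (d + 1)), ‖DelK k hk (fine (Lb * 1) M₁) a ha q' q‖ ≤
      c₀ * Real.exp (-(δc * torusSupNorm (fine (Lb * 1) M₁) (rep (fine (Lb * 1) M₁) q'.1 - rep (fine (Lb * 1) M₁) q.1))) := fun k _ hk q' q =>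
    (hker k hk (fine (Lb * 1) M₁) a ha q' q).trans (mul_le_mul_of_nonneg_left
      (B9FromB6.decay_mono hδcδ₀ (B4TorusKernel.MultiPeriod.torusSupNorm_nonneg (one_le_M _) _)) hc₀.le)
  have hHent : ∀ x x' : Tor (fine (Lb * 1) M₁) × Fin (d + 1), |reM (DelK n hn (fine (Lb * 1) M₁) a ha) x x'| ≤
      h₀ * Real.exp (-(δH * (tdist (par 1 Lb M₁ x.1) (par 1 Lb M₁ x'.1) : ℝ))) := fun x x' => by
    rw [hh₀, hδH]; exact abs_reDelK_le_par Lb n hn a ha M₁ hc₀.le hδc0.le (hkerc n hn) x x'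
  have hHent' : ∀ x x' : Tor (fine (Lb * 1) M₁) × Fin (d + 1), |reM (DelK n' hn' (fine (Lb * 1) M₁) a ha) x x'| ≤
      h₀ * Real.exp (-(δH * (tdist (par 1 Lb M₁ x.1) (par 1 Lb M₁ x'.1) : ℝ))) := fun x x' => by
    rw [hh₀, hδH]; exact abs_reDelK_le_par Lb n' hn' a ha M₁ hc₀.le hδc0.le (hkerc n' hn') x x'
  -- the difference letter at the common rate
  obtain ⟨ε, hε⟩ : ∃ ε : ℝ, ε = Cd * ((n : ℝ) ^ 2)⁻¹ * Real.exp (δc * ((Lb : ℝ) - 1)) := ⟨_, rfl⟩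
  have hε0 : 0 ≤ ε := by rw [hε]; positivity
  have hdiff0 : ∀ s s' : Tor (fine (Lb * 1) M₁) × Fin (d + 1), |(DelK n' hn' (fine (Lb * 1) M₁) a ha s s').re - (DelK n hn (fine (Lb * 1) M₁) a ha s s').re| ≤
      Cd * ((n : ℝ) ^ 2)⁻¹ * Real.exp (-(δc * pdist (fine (Lb * 1) M₁) (one_le_M (fine (Lb * 1) M₁)) (rep (fine (Lb * 1) M₁) s.1) (rep (fine (Lb * 1) M₁) s'.1))) := by
    intro s s'
    have h1 := abs_reDelK_sub_le (fine (Lb * 1) M₁) hn hn' hnn' ((idxEquiv (fine (Lb * 1) M₁)).symm s) ((idxEquiv (fine (Lb * 1) M₁)).symm s')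
    rw [reDelK_apply n' hn' (fine (Lb * 1) M₁) a ha, reDelK_apply n hn (fine (Lb * 1) M₁) a ha, Equiv.apply_symm_apply, Equiv.apply_symm_apply] at h1
    refine h1.trans ?_
    rw [← hCd]
    refine mul_le_mul_of_nonneg_left (B9FromB6.decay_mono hδcκ ?_) (by positivity)
    exact B4Sect5Torus.tdist_nonneg _ _ _
  have hdiff : ∀ x x' : Tor (fine (Lb * 1) M₁) × Fin (d + 1), |(reM (DelK n hn (fine (Lb * 1) M₁) a ha) - reM (DelK n' hn' (fine (Lb * 1) M₁) a ha)) x x'| ≤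
      ε * Real.exp (-(δH * (tdist (par 1 Lb M₁ x.1) (par 1 Lb M₁ x'.1) : ℝ))) := fun x x' => by
    rw [hε, hδH]; exact abs_reDelK_sub_le_par Lb a ha M₁ n n' hn hn' (by positivity : (0 : ℝ) ≤ Cd * ((n : ℝ) ^ 2)⁻¹) hδc0.le hdiff0 x x'
  obtain ⟨εE, hεE⟩ : ∃ εE : ℝ, εE = (2 / γK) ^ 2 * ε * (((d + 1 : ℕ) : ℝ) * (Lb : ℝ) ^ (d + 1) * Kf (rF / 2)) ^ 2 := ⟨_, rfl⟩
  have hεE0 : 0 ≤ εE := by rw [hεE]; positivity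
  have hεEle : εE ≤ εEM := by
    rw [hεE, hεEM]
    have h3 : ε ≤ εM := by
      rw [hε, hεM]
      have := mul_le_mul_of_nonneg_left hn2le (by positivity : (0 : ℝ) ≤ Cd * Real.exp (δc * ((Lb : ℝ) - 1)))
      linarith [this]
    exact mul_le_mul_of_nonneg_right (mul_le_mul_of_nonneg_left h3 (by positivity)) (by positivity)
  -- PART 182's END with these letters
  have hmain := abs_flucCov_sub_le_DelK_axial Lb M₁ a ha hd' n n' hn hn' hKf0 (fun s hs y => hKf' s hs (fine 1 M₁) y) hh₀0 hδH0 hHent hHent' hε0 hdiff ha'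
    hh hγK hcK hrF hr hc₀' hc₁ hΛ hεE hrU' x x'
  refine hmain.trans ?_
  -- absorb the quadratic terms (`εE ≤ εEM` since `n ≥ 1`) and read off `C·n⁻²`
  have hrate := rateConst_le (r := r) (K1 := (((d + 1 : ℕ) : ℝ) * (1 + (Lb : ℝ) ^ (d + 1)) * Kf (rU' / 2))) (K3 := (((d + 1 : ℕ) : ℝ) * (1 + (Lb : ℝ) ^ (d + 1)) * Kf (min r rU' / 2)))
    hεE0 hεEle (by positivity : (0 : ℝ) ≤ Λ + a') hc₁0 hK2 hK4
  refine (mul_le_mul_of_nonneg_right hrate (Real.exp_pos _).le).trans (le_of_eq ?_)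
  rw [hεE, hε, hεEM, hεM]
  ring

end Assembled

end Summit.QuantumFields.BalabanUV.Beta.GAN24.OneStepConstraintAxialDelKRate

end
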